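import Summits.ABC.IUTFork.Joshi.TestRealHonestPacketDH
import Summits.ABC.IUTFork.Joshi.TestRealRescalingHorn
import HarnessLib

/-!
# Branch E TEST vs S — X-07′ REPLICATED AT THE REAL CARRIERS: at the honest real setting a Joshi-style rescaling «Ism»
# REACHES S-by-moves (`IndCoversQ`) while the printed Statement FAILS AS TYPED (abc-iut-E-t41; reader-companion of p436769)

Companion of `Joshi/TestRealHonestPacket.lean` (p440805: `honestSetting`, the INHABITED honest `Cor312.Setting` over abc-iut-E-t43's
`latticeSituationReal` for EVERY (Ind1)/(Ind2) binder `Aut`/`Ism`; Θ-images `e⁻¹(p·𝒪_L)`, `q`-image `e⁻¹(𝒪_L)`), of its DH companion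
(p441827) and of E-t43's `Joshi/TestRealRescalingHorn.lean` (p436769: `pHomothety`, `hornFamily`, `real_rescaling_horn`). PROOF-ONLY.
Suppose the (Ind2) BINDER «Ism» contains at every place the homothety `y ↦ p·y` (`hhom`; Joshi's «ℚ_p-linear isomorphism σ»,
[J-III] arXiv:2401.13508v4 §8.11.1 p.91 l.37–44, READ additively on `K_v` — E-t43's dictionary step; R17: a JOSHI-SIDE enlargement, no
Mochizuki-side (Ind2) claim). Then AT THE HONEST SETTING (same prime `p` for the boxes and the homothety):
* `honest_rescaling_horn` — `¬ Statement ∧ ¬ BridgeHyps` with NO structural binder left (p436769's `ThetaRegionsAdm P` is p440805's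
  `thetaRegionsAdm_honestSetting`): the blow-up horn is inhabited by a CONCRETE setting.
* `hornFamily_mem_thetaRegion` — the (Ind2)-generator `⊗_i ⊕_v (p·)` maps the `q`-image INTO every Θ-image at EVERY packet: over a prime
  `p₀` it multiplies each field-factor coordinate by `p^{j+1}` (`factorMapDH_hornFamily`), and `‖p^{j+1}·c‖ ≤ ‖p‖` whenever `‖c‖ ≤ 1`
  (`‖p‖_{p₀} ≤ 1`); at `∞` there is no factor.
* `honest_indCoversQ_of_hom` — hence for every reading `ρ` / `q`-datum `qK` satisfying the Corollary's own two region pins, **`IndCoversQ`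
  HOLDS**: the `q`-datum region is the translate by `hornFamily⁻¹ ∈ ⟨(Ind1) ∪ (Ind2)⟩` of (a subset of) the Θ-datum region — S-by-moves
  is REACHED; with `honest_horn_profile` : `IndCoversQ ∧ ¬ Statement ∧ ¬ BridgeHyps`, and the packaged `exists_pinnedReading_horn_profile`.
TOGETHER WITH p441827 (`honestDH_not_indCoversQ`: at the Dupuy–Hilado isometries `¬ IndCoversQ`) this is abc-iut-E-t41 gen 0's X-07′
dichotomy (p431588/p431886, toy carriers `ℚ`) REPLICATED AT THE TREE'S REAL CARRIERS on ONE inhabited honest setting: «isometric Ism ⇒ S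
unreachable by moves; Ism ∋ (y ↦ p·y) ⇒ S-by-moves reached AND `−|log(Θ)| = ⊤` as typed». HONEST SCOPE: `IndCoversQ` is the CONTAINMENT
shape (abc-iut-E-cx's `TestHarness`), not S = `PilotKummerIndRelated` (which needs Thm. 3.11 (ii)(b) and the (hρ)-half of the Θ-pin —
NOT claimed; E-cx-2's hand item (a′)); the boxes are the printed SHAPE of the pilot line bundles, not [IUTchIII] Def. 3.8 (i)'s Θ-pilot.
**No side is taken** on [IUTchIII] Cor. 3.12 or on any author (Mochizuki / Scholze–Stix / Joshi / Dupuy–Hilado); typed ≠ proved ≠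
endorsed; located, not adjudicated. [claim: Joshi2024ATS3, status: disputed] [claim: Mochizuki2012, status: disputed]
[cite: DupuyHilado2025, Def. 3.6.1, §4.7–4.9]. Standard axioms only; no `sorry`; R14: a `Joshi/Test*` file.
-/

noncomputable section

open Set Function
open scoped Pointwise

namespace Summit.ABC.IUTFork.Joshi

open Thm311 Thm311.Real Cor312 Cor312Vol Literature.IUT.LogThetaLattice Literature.IUT.LogVolume

section Horn

variable {F : Type} [Field F] [NumberField F] (p : ℕ) [hp : Fact p.Prime] (X : PilotData F) {logv : PadicLogs F}
  (hlog : LogvAnalytic logv) (Aut Ism : ∀ x : Place F, Set (Carrier x ≃ₗ[ℚ] Carrier x))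
  (hAut : ∀ x, LinearEquiv.refl ℚ (Carrier x) ∈ Aut x) (hIsm : ∀ x, LinearEquiv.refl ℚ (Carrier x) ∈ Ism x)

/-! ## 1. The horn family in field-factor coordinates over ANY prime `p₀`: multiplication by `p^{j+1}` -/

/-- At a place over any prime `p₀`, c312-5's `φ_v` intertwines the homothety `y ↦ p·y` with `ℚ_{p₀}`-scalar multiplication by `p`
(E-t43's `φ_pHomothety`, any residue characteristic). [folklore] -/
theorem φ_pHomothety_at (pp : Nat.Primes) (x : (thetaIndex X).Fibre (Sum.inr pp : (thetaIndex X).VQ))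
    (y : (logShellsDH X logv).carrier x.1) :
    haveI : Fact (pp : ℕ).Prime := ⟨pp.2⟩
    (presAt X hlog pp).φ x (pHomothety p x.1 y) =
      (LinearEquiv.smulOfNeZero (K := ℚ_[pp]) (M := (presAt X hlog pp).k x) ((p : ℕ) : ℚ_[pp])
        (Nat.cast_ne_zero.2 hp.out.ne_zero)) ((presAt X hlog pp).φ x y) := by
  haveI : Fact (pp : ℕ).Prime := ⟨pp.2⟩
  change (presAt X hlog pp).φ x (((p : ℕ) : ℚ) • y) = ((p : ℕ) : ℚ_[pp]) • (presAt X hlog pp).φ x y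
  rw [LinearEquiv.map_smul]
  have h := ratCast_smul_eq ℚ ℚ_[pp] ((p : ℕ) : ℚ) ((presAt X hlog pp).φ x y)
  rw [Rat.cast_natCast, Rat.cast_natCast] at h
  exact h

/-- `⊗_a (p·)` is the scalar `p^{#S^±_{j+1}}` on each real summand over `p₀` (E-t43's `congr_smul_apply`, any `p₀`). [folklore] -/
theorem congr_smul_apply_at (pp : Nat.Primes) {j : (thetaIndex X).Label}
    (e : (thetaIndex X).Caps j → (thetaIndex X).Fibre (Sum.inr pp : (thetaIndex X).VQ)) :
    haveI : Fact (pp : ℕ).Prime := ⟨pp.2⟩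
    ∀ z : (presAt X hlog pp).X e,
      (PiTensorProduct.congr fun a =>
          LinearEquiv.smulOfNeZero (K := ℚ_[pp]) (M := (presAt X hlog pp).k (e a)) ((p : ℕ) : ℚ_[pp])
            (Nat.cast_ne_zero.2 hp.out.ne_zero)) z =
        (((p : ℕ) : ℚ_[pp]) ^ Fintype.card ((thetaIndex X).Caps j)) • z := by
  haveI : Fact (pp : ℕ).Prime := ⟨pp.2⟩
  intro z
  have key : ((PiTensorProduct.congr fun a =>
        LinearEquiv.smulOfNeZero (K := ℚ_[pp]) (M := (presAt X hlog pp).k (e a)) ((p : ℕ) : ℚ_[pp])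
          (Nat.cast_ne_zero.2 hp.out.ne_zero)) : (presAt X hlog pp).X e ≃ₗ[ℚ_[pp]] _).toLinearMap =
      (((p : ℕ) : ℚ_[pp]) ^ Fintype.card ((thetaIndex X).Caps j)) • LinearMap.id := by
    refine PiTensorProduct.ext (MultilinearMap.ext fun y => ?_)
    simp only [LinearMap.compMultilinearMap_apply, LinearEquiv.coe_coe, PiTensorProduct.congr_tprod,
      LinearMap.smul_apply, LinearMap.id_apply]
    change PiTensorProduct.tprod ℚ_[pp] (fun a => ((p : ℕ) : ℚ_[pp]) • y a) = _
    rw [MultilinearMap.map_smul_univ, Finset.prod_const, Finset.card_univ]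
  exact LinearMap.congr_fun key z

/-- **The horn family multiplies every summand component of the comparison by `p^{j+1}`** over any prime `p₀`
(E-t43's naturality square `realDH_comparison_factorwise`). [folklore] -/
theorem comparison_hornFamily (pp : Nat.Primes) {j : (thetaIndex X).Label}
    (x : (logShells X logv Aut Ism hAut hIsm).Packet j (Sum.inr pp))
    (e : (thetaIndex X).Caps j → (thetaIndex X).Fibre (Sum.inr pp : (thetaIndex X).VQ)) :
    haveI : Fact (pp : ℕ).Prime := ⟨pp.2⟩
    (presAt X hlog pp).comparison j (hornFamily p X Aut Ism hAut hIsm j (Sum.inr pp) x) e =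
      (((p : ℕ) : ℚ_[pp]) ^ Fintype.card ((thetaIndex X).Caps j)) • (presAt X hlog pp).comparison j x e := by
  haveI : Fact (pp : ℕ).Prime := ⟨pp.2⟩
  have h := congrFun (realDH_comparison_factorwise X hlog (pp : ℕ) (j := j) (fun _ v => pHomothety p v.1)
    (fun _ v => LinearEquiv.smulOfNeZero (K := ℚ_[pp]) (M := (presAt X hlog pp).k v) ((p : ℕ) : ℚ_[pp])
      (Nat.cast_ne_zero.2 hp.out.ne_zero))
    (fun _ v y => φ_pHomothety_at p X hlog pp v y) x) e
  exact h.trans (congr_smul_apply_at p X hlog pp e _)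

/-- **In field-factor coordinates the horn family is multiplication by `p^{j+1}`** over any prime. [folklore] -/
theorem dEquiv_comparison_hornFamily (pp : Nat.Primes) {j : (thetaIndex X).Label}
    (x : (logShells X logv Aut Ism hAut hIsm).Packet j (Sum.inr pp)) (s : factorIdxDH X hlog j (.inr pp)) :
    haveI : Fact (pp : ℕ).Prime := ⟨pp.2⟩
    dEquiv (pp : ℕ) ((presAt X hlog pp).kk s.1)
        ((presAt X hlog pp).comparison j (hornFamily p X Aut Ism hAut hIsm j (.inr pp) x) s.1) s.2 =
      (((p : ℕ) : ℚ_[pp]) ^ Fintype.card ((thetaIndex X).Caps j)) •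
        dEquiv (pp : ℕ) ((presAt X hlog pp).kk s.1) ((presAt X hlog pp).comparison j x s.1) s.2 := by
  haveI : Fact (pp : ℕ).Prime := ⟨pp.2⟩
  rw [comparison_hornFamily p X hlog Aut Ism hAut hIsm pp x s.1, map_smul, Pi.smul_apply]

/-- **Over any prime the horn family maps the `q`-box `𝒪_L` INTO the Θ-box `p·𝒪_L`** in field-factor coordinates:
`‖p^{j+1}·c‖ = ‖p‖^{j+1}·‖c‖ ≤ ‖p‖` for `‖c‖ ≤ 1`. [cite: DupuyHilado2025, Def. 3.6.1] -/
theorem factorMapDH_hornFamily_mem (pp : Nat.Primes) {j : (thetaIndex X).Label}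
    (x : (logShells X logv Aut Ism hAut hIsm).Packet j (Sum.inr pp))
    (hx : factorMapDH X hlog j (.inr pp) x ∈ hullSet (factorFieldDH X hlog j (.inr pp)) (fun _ => 1)) :
    factorMapDH X hlog j (.inr pp) (hornFamily p X Aut Ism hAut hIsm j (.inr pp) x) ∈
      hullSet (factorFieldDH X hlog j (.inr pp)) (fun s => (p : factorFieldDH X hlog j (.inr pp) s)) := by
  haveI : Fact (pp : ℕ).Prime := ⟨pp.2⟩
  rw [hullSet, mem_polydisc] at hx ⊢
  intro s
  have hxs : ‖dEquiv (pp : ℕ) ((presAt X hlog pp).kk s.1) ((presAt X hlog pp).comparison j x s.1) s.2‖ ≤ 1 := by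
    have h := hx s
    rw [norm_one] at h
    exact h
  have hpK : ‖(p : DFac (pp : ℕ) ((presAt X hlog pp).kk s.1) s.2)‖ = ‖((p : ℕ) : ℚ_[pp])‖ := by
    rw [← map_natCast (algebraMap ℚ_[pp] (DFac (pp : ℕ) ((presAt X hlog pp).kk s.1) s.2)) p, norm_algebraMap']
  show ‖dEquiv (pp : ℕ) ((presAt X hlog pp).kk s.1)
      ((presAt X hlog pp).comparison j (hornFamily p X Aut Ism hAut hIsm j (.inr pp) x) s.1) s.2‖ ≤
    ‖(p : DFac (pp : ℕ) ((presAt X hlog pp).kk s.1) s.2)‖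
  rw [hpK, dEquiv_comparison_hornFamily p X hlog Aut Ism hAut hIsm pp x s, norm_smul, norm_pow]
  calc ‖((p : ℕ) : ℚ_[pp])‖ ^ Fintype.card ((thetaIndex X).Caps j) *
        ‖dEquiv (pp : ℕ) ((presAt X hlog pp).kk s.1) ((presAt X hlog pp).comparison j x s.1) s.2‖
      ≤ ‖((p : ℕ) : ℚ_[pp])‖ ^ Fintype.card ((thetaIndex X).Caps j) * 1 :=
        mul_le_mul_of_nonneg_left hxs (pow_nonneg (norm_nonneg _) _)
    _ ≤ ‖((p : ℕ) : ℚ_[pp])‖ := by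
        have hp1 : ‖((p : ℕ) : ℚ_[pp])‖ ≤ 1 := by  -- `‖p‖_{p₀} ≤ 1` (tree: `norm_natCast_le_one`-type lemmas)
          simpa using Padic.norm_int_le_one (p := (pp : ℕ)) (p : ℤ)
        rw [mul_one]
        exact pow_le_of_le_one (norm_nonneg _) hp1 Fintype.card_ne_zero

/-! ## 2. At the honest setting: `q`-image ↦ Θ-image, `IndCoversQ`, and the profile -/

variable (M : Type) [Field M] [NumberField M]
  (archPk : ∀ (j : (thetaIndex X).Label) (vQ : (thetaIndex X).VQ), Set ((logShells X logv Aut Ism hAut hIsm).Packet j vQ))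
  (archSub : ∀ (j : (thetaIndex X).Label) (v : (thetaIndex X).V),
    Set ((logShells X logv Aut Ism hAut hIsm).Packet j ((thetaIndex X).over v)))
  (Ψ : ℤ → ∀ v : (thetaIndex X).V, v ∈ (thetaIndex X).Vbad → Set ((logShells X logv Aut Ism hAut hIsm).StarPacket v))
  (act : ℤ → ∀ v : (thetaIndex X).V, v ∈ (thetaIndex X).Vbad →
    (logShells X logv Aut Ism hAut hIsm).StarPacket v → Module.End ℚ ((logShells X logv Aut Ism hAut hIsm).StarPacket v))
  (Mmod : ℤ → ∀ j : (thetaIndex X).LabelStar, Set ((logShells X logv Aut Ism hAut hIsm).GlobalPacket j.1))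
  (region : ℤ → ∀ j : (thetaIndex X).LabelStar, FinDivisor M → ∀ vQ : (thetaIndex X).VQ,
    Set ((logShells X logv Aut Ism hAut hIsm).Packet j.1 vQ))
  (col : ℤ → Column (logShells X logv Aut Ism hAut hIsm)) (n : ℤ)

/-- **The horn family maps the `q`-image `e⁻¹(𝒪_L)` INTO every Θ-image `e⁻¹(p·𝒪_L)` of the honest setting, at EVERY packet.**
[claim: Mochizuki2012, status: disputed] -/
theorem hornFamily_mem_thetaRegion (m : ℤ) (j : (thetaIndex X).Label) (vQ : (thetaIndex X).VQ)
    (x : (logShells X logv Aut Ism hAut hIsm).Packet j vQ)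
    (hx : x ∈ (honestSetting X hlog Aut Ism hAut hIsm M archPk archSub Ψ act Mmod region col n p).qRegion j vQ) :
    hornFamily p X Aut Ism hAut hIsm j vQ x ∈
      (honestSetting X hlog Aut Ism hAut hIsm M archPk archSub Ψ act Mmod region col n p).thetaRegion m j vQ := by
  rcases vQ with u | pp
  · show factorMapDH X hlog j (.inl u) (hornFamily p X Aut Ism hAut hIsm j (.inl u) x) ∈
      hullSet (factorFieldDH X hlog j (.inl u)) (fun s => (p : factorFieldDH X hlog j (.inl u) s))
    rw [hullSet, mem_polydisc]
    exact fun s => s.elim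
  · exact factorMapDH_hornFamily_mem p X hlog Aut Ism hAut hIsm pp x hx

/-- **The horn is inhabited by a CONCRETE setting — `honest_rescaling_horn`**: if «Ism» contains `y ↦ p·y` at every place, the printed
Statement and `BridgeHyps` FAIL AS TYPED at the honest setting (E-t43's `real_rescaling_horn`, its binder `ThetaRegionsAdm` supplied by
p440805). Located, not adjudicated. [claim: Joshi2024ATS3, status: disputed] [claim: Mochizuki2012, status: disputed] -/
theorem honest_rescaling_horn (hhom : ∀ x : Place F, pHomothety p x ∈ Ism x) :
    ¬ (honestSetting X hlog Aut Ism hAut hIsm M archPk archSub Ψ act Mmod region col n p).Statement ∧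
      ¬ BridgeHyps (honestSetting X hlog Aut Ism hAut hIsm M archPk archSub Ψ act Mmod region col n p) :=
  real_rescaling_horn p X hlog Aut Ism hAut hIsm M archPk archSub Ψ act Mmod region col hhom _ thetaRegionsAdm_honestSetting

variable (ρ : (∀ v : (thetaIndex X).V, v ∈ (thetaIndex X).Vbad → Set ((logShells X logv Aut Ism hAut hIsm).StarPacket v)) →
    ∀ (j : (thetaIndex X).Label) (vQ : (thetaIndex X).VQ), Set ((logShells X logv Aut Ism hAut hIsm).Packet j vQ))
  (qK : ∀ v : (thetaIndex X).V, v ∈ (thetaIndex X).Vbad → Set ((logShells X logv Aut Ism hAut hIsm).StarPacket v))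

/-- **S-BY-MOVES IS REACHED at the honest setting — `honest_indCoversQ_of_hom`**: if «Ism» contains `y ↦ p·y` at every place, then for
every reading `ρ` / `q`-datum `qK` satisfying the Corollary's own two region pins, at EVERY packet the `q`-datum region is contained in the
translate by `hornFamily⁻¹ ∈ ⟨(Ind1) ∪ (Ind2)⟩` of the (column-`0`) Θ-datum region: `IndCoversQ`. Located, not adjudicated.
[claim: Joshi2024ATS3, status: disputed] [claim: Mochizuki2012, status: disputed] -/
theorem honest_indCoversQ_of_hom (hhom : ∀ x : Place F, pHomothety p x ∈ Ism x)
    (hΘpin : ∀ (m : ℤ) (j : (thetaIndex X).Label) (vQ : (thetaIndex X).VQ),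
      (honestSetting X hlog Aut Ism hAut hIsm M archPk archSub Ψ act Mmod region col n p).thetaRegion m j vQ =
        ρ ((col n).frobΨ m) j vQ)
    (hqpin : ∀ (j : (thetaIndex X).Label) (vQ : (thetaIndex X).VQ),
      (honestSetting X hlog Aut Ism hAut hIsm M archPk archSub Ψ act Mmod region col n p).qRegion j vQ = ρ qK j vQ) :
    IndCoversQ (latticeSituationReal X hlog Aut Ism hAut hIsm M archPk archSub Ψ act Mmod region col)
      (honestSetting X hlog Aut Ism hAut hIsm M archPk archSub Ψ act Mmod region col n p) ρ qK := by
  intro j vQ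
  refine ⟨(hornFamily p X Aut Ism hAut hIsm (logv := logv))⁻¹,
    Subgroup.inv_mem _ (Subgroup.subset_closure (Or.inr (hornFamily_mem_Ind2Family p hhom))), 0, ?_⟩
  rw [← hqpin j vQ]
  intro x hx
  refine ⟨hornFamily p X Aut Ism hAut hIsm j vQ x, ?_, ?_⟩
  · show hornFamily p X Aut Ism hAut hIsm j vQ x ∈ ρ ((col n).frobΨ 0) j vQ
    rw [← hΘpin 0 j vQ]
    exact hornFamily_mem_thetaRegion p X hlog Aut Ism hAut hIsm M archPk archSub Ψ act Mmod region col n 0 j vQ x hx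
  · show (hornFamily p X Aut Ism hAut hIsm j vQ).symm (hornFamily p X Aut Ism hAut hIsm j vQ x) = x
    exact LinearEquiv.symm_apply_apply _ _

/-- **X-07′ AT THE REAL CARRIERS — `honest_horn_profile`**: with «Ism» ∋ (`y ↦ p·y`), at the honest setting and every pinned reading:
`IndCoversQ` (S-by-moves reached) AND `¬ Statement ∧ ¬ BridgeHyps` (`−|log(Θ)| = ⊤` as typed). Compare p441827 `honestDH_not_indCoversQ`
(Dupuy–Hilado isometries: `¬ IndCoversQ`). Located, not adjudicated. [claim: Joshi2024ATS3, status: disputed] [claim: Mochizuki2012, status: disputed] -/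
theorem honest_horn_profile (hhom : ∀ x : Place F, pHomothety p x ∈ Ism x)
    (hΘpin : ∀ (m : ℤ) (j : (thetaIndex X).Label) (vQ : (thetaIndex X).VQ),
      (honestSetting X hlog Aut Ism hAut hIsm M archPk archSub Ψ act Mmod region col n p).thetaRegion m j vQ =
        ρ ((col n).frobΨ m) j vQ)
    (hqpin : ∀ (j : (thetaIndex X).Label) (vQ : (thetaIndex X).VQ),
      (honestSetting X hlog Aut Ism hAut hIsm M archPk archSub Ψ act Mmod region col n p).qRegion j vQ = ρ qK j vQ) :
    IndCoversQ (latticeSituationReal X hlog Aut Ism hAut hIsm M archPk archSub Ψ act Mmod region col)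
        (honestSetting X hlog Aut Ism hAut hIsm M archPk archSub Ψ act Mmod region col n p) ρ qK ∧
      ¬ (honestSetting X hlog Aut Ism hAut hIsm M archPk archSub Ψ act Mmod region col n p).Statement ∧
      ¬ BridgeHyps (honestSetting X hlog Aut Ism hAut hIsm M archPk archSub Ψ act Mmod region col n p) :=
  ⟨honest_indCoversQ_of_hom p X hlog Aut Ism hAut hIsm M archPk archSub Ψ act Mmod region col n ρ qK hhom hΘpin hqpin,
    honest_rescaling_horn p X hlog Aut Ism hAut hIsm M archPk archSub Ψ act Mmod region col n hhom⟩

/-- **Packaged**: with «Ism» ∋ (`y ↦ p·y`), for EVERY column family there EXIST a reading and a `q`-datum satisfying the two region pins at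
the honest setting with `IndCoversQ ∧ ¬ Statement ∧ ¬ BridgeHyps` (pinned readings: p441827 `exists_pinnedReading'`). [folklore] -/
theorem exists_pinnedReading_horn_profile (hhom : ∀ x : Place F, pHomothety p x ∈ Ism x) :
    ∃ (ρ' : (∀ v : (thetaIndex X).V, v ∈ (thetaIndex X).Vbad → Set ((logShells X logv Aut Ism hAut hIsm).StarPacket v)) →
        ∀ (j : (thetaIndex X).Label) (vQ : (thetaIndex X).VQ), Set ((logShells X logv Aut Ism hAut hIsm).Packet j vQ))
      (qK' : ∀ v : (thetaIndex X).V, v ∈ (thetaIndex X).Vbad → Set ((logShells X logv Aut Ism hAut hIsm).StarPacket v)),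
      (∀ (m : ℤ) (j : (thetaIndex X).Label) (vQ : (thetaIndex X).VQ),
          (honestSetting X hlog Aut Ism hAut hIsm M archPk archSub Ψ act Mmod region col n p).thetaRegion m j vQ =
            ρ' ((col n).frobΨ m) j vQ) ∧
        (∀ (j : (thetaIndex X).Label) (vQ : (thetaIndex X).VQ),
          (honestSetting X hlog Aut Ism hAut hIsm M archPk archSub Ψ act Mmod region col n p).qRegion j vQ = ρ' qK' j vQ) ∧
        IndCoversQ (latticeSituationReal X hlog Aut Ism hAut hIsm M archPk archSub Ψ act Mmod region col)
          (honestSetting X hlog Aut Ism hAut hIsm M archPk archSub Ψ act Mmod region col n p) ρ' qK' ∧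
        ¬ (honestSetting X hlog Aut Ism hAut hIsm M archPk archSub Ψ act Mmod region col n p).Statement ∧
        ¬ BridgeHyps (honestSetting X hlog Aut Ism hAut hIsm M archPk archSub Ψ act Mmod region col n p) := by
  obtain ⟨ρ', qK', hΘ, hq⟩ :=
    exists_pinnedReading' X hlog Aut Ism hAut hIsm M archPk archSub Ψ act Mmod region col n p
  exact ⟨ρ', qK', hΘ, hq,
    honest_horn_profile p X hlog Aut Ism hAut hIsm M archPk archSub Ψ act Mmod region col n ρ' qK' hhom hΘ hq⟩

end Horn

/-! ## 3. The Dupuy–Hilado side packaged in ONE name (abc-iut-E-t21's composition guard) -/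

section DH

variable {F : Type} [Field F] [NumberField F] (X : PilotData F) {logv : PadicLogs F} (hlog : LogvAnalytic logv)
  (M : Type) [Field M] [NumberField M]
  (archPk : ∀ (j : (thetaIndex X).Label) (vQ : (thetaIndex X).VQ), Set ((logShellsDH X logv).Packet j vQ))
  (archSub : ∀ (j : (thetaIndex X).Label) (v : (thetaIndex X).V), Set ((logShellsDH X logv).Packet j ((thetaIndex X).over v)))
  (Ψ : ℤ → ∀ v : (thetaIndex X).V, v ∈ (thetaIndex X).Vbad → Set ((logShellsDH X logv).StarPacket v))
  (act : ℤ → ∀ v : (thetaIndex X).V, v ∈ (thetaIndex X).Vbad →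
    (logShellsDH X logv).StarPacket v → Module.End ℚ ((logShellsDH X logv).StarPacket v))
  (Mmod : ℤ → ∀ j : (thetaIndex X).LabelStar, Set ((logShellsDH X logv).GlobalPacket j.1))
  (region : ℤ → ∀ j : (thetaIndex X).LabelStar, FinDivisor M → ∀ vQ : (thetaIndex X).VQ, Set ((logShellsDH X logv).Packet j.1 vQ))
  (col : ℤ → Column (logShellsDH X logv)) (n : ℤ) (p : ℕ) [hp : Fact p.Prime]

/-- **X-06-REAL NON-VACUITY in one name**: at the Dupuy–Hilado binders, for EVERY column family there EXIST a reading and a `q`-datum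
satisfying the two region pins at the honest setting with `¬ IndCoversQ` (p441827's two halves composed). [folklore] -/
theorem exists_pinnedReading_not_indCoversQ_DH :
    ∃ (ρ : (∀ v : (thetaIndex X).V, v ∈ (thetaIndex X).Vbad → Set ((logShellsDH X logv).StarPacket v)) →
        ∀ (j : (thetaIndex X).Label) (vQ : (thetaIndex X).VQ), Set ((logShellsDH X logv).Packet j vQ))
      (qK : ∀ v : (thetaIndex X).V, v ∈ (thetaIndex X).Vbad → Set ((logShellsDH X logv).StarPacket v)),
      (∀ (m : ℤ) (j : (thetaIndex X).Label) (vQ : (thetaIndex X).VQ),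
          (honestSetting X hlog stripAutDH (ismDH logv) refl_mem_stripAutDH (refl_mem_ismDH logv) M archPk archSub Ψ act Mmod
            region col n p).thetaRegion m j vQ = ρ ((col n).frobΨ m) j vQ) ∧
        (∀ (j : (thetaIndex X).Label) (vQ : (thetaIndex X).VQ),
          (honestSetting X hlog stripAutDH (ismDH logv) refl_mem_stripAutDH (refl_mem_ismDH logv) M archPk archSub Ψ act Mmod
            region col n p).qRegion j vQ = ρ qK j vQ) ∧
        ¬ IndCoversQ (latticeSituationReal X hlog stripAutDH (ismDH logv) refl_mem_stripAutDH (refl_mem_ismDH logv) M archPk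
            archSub Ψ act Mmod region col)
          (honestSetting X hlog stripAutDH (ismDH logv) refl_mem_stripAutDH (refl_mem_ismDH logv) M archPk archSub Ψ act Mmod
            region col n p) ρ qK := by
  obtain ⟨ρ, qK, hΘ, hq⟩ := exists_pinnedReading' X hlog stripAutDH (ismDH logv) refl_mem_stripAutDH (refl_mem_ismDH logv)
    M archPk archSub Ψ act Mmod region col n p
  exact ⟨ρ, qK, hΘ, hq, honestDH_not_indCoversQ X hlog hΘ hq⟩

end DH

end Summit.ABC.IUTFork.Joshi

end
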